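import Summits.QuantumFields.GaugeBoot.LoopEquationInstances
import Summits.QuantumFields.GaugeBoot.WordLoop
import Summits.QuantumFields.GaugeBoot.Targets
import HarnessLib

/-!
# The `SU(2)` loop equations (1eq), (2eq) in every dimension, in the cell's real loop variables (cell `gauge-boot`, L1)

Honest framing (cell rule): certified bounds on lattice expectations at stated coupling, gauge group, dimension and
torus size; NOT a mass gap, NOT a continuum limit, NOT a string tension; not summit-bearing
(`FixedCouplingUltralocality`, `PerturbativeInvisibility`).

`LoopEquationInstances.lean` wrote the plaquette row (1eq) and the spur-plaquette row (2eq) out in `d = 2`.  Here the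
same two rows are written out for `SU(2)` in EVERY dimension `d`, in the loop variables
`E_w = ⟨W_x(w)⟩ = wilsonExpectation (suRep 2) β (wordLoop (suRep 2) x w)` of `GaugeBoot/WordLoop.lean`
(`W = ½ Re tr`), keeping the sum over the `2(d − 1)` plaquettes through the link `(x, μ)`:

* `oneEq_specialUnitaryGroup_dim`, `twoEq_specialUnitaryGroup_dim`, `oneEq_unitaryGroup_dim`, `twoEq_unitaryGroup_dim` :
  the two rows for `SU(N)` / `U(N)` in every dimension (complex trace form, as in `LoopEquationInstances`);
* `integral_plaqTerm_su_two` : for `SU(2)` every plaquette term integrates to `2(E_{w·P̃} − E_{w·P̃⁻¹})`;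
* `oneEq_su_two_wordLoop` : `3·E_P + β·Σ_{ν' ≠ μ} Σ_{ε = ±} (E_{P·P̃(ν',ε)} − E_{P·P̃(ν',ε)⁻¹}) = 0`, `P = +μ +ν −μ −ν`;
* `twoEq_su_two_wordLoop` : `β·Σ_{ν' ≠ μ} Σ_{ε} (E_{S·P̃(ν',ε)} − E_{S·P̃(ν',ε)⁻¹}) = 0`, `S = +μ +μ +ν −μ −ν −μ`;
* helpers to expand the plaquette sum in `d = 3`, `d = 4` (`univ_erase_zero_fin_three/four`) and the trivial
  in-plane backtracking term `E_{P·P⁻¹} = 1` (`wilsonExpectation_wordLoop_plaquette_append_reverse`); the expanded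
  rows are, per transverse axis, the bent / double-bent words on top of the `d = 2` system — the raw form of the two
  loop-equation rows of the cell's rung-0 `D = 3` / `D = 4` certificates, identified with their 11 / 12 canonical
  variables in `Rung0D3LoopEquations.lean` / `Rung0D4LoopEquations.lean` (lean1's class tables `Rung0D3*` / `Rung0D4*`).
Here `β` is the tree coupling `β_std/2`.  Everything is `[folklore]` (Makeenko–Migdal / Kazakov–Zheng rows).
-/

noncomputable section

open MeasureTheory
open scoped Matrix
open Literature.MathematicalPhysics.QuantumFieldTheory
open Literature.MathematicalPhysics.QuantumLattice

namespace Summit.QuantumFields.GaugeBoot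

variable {d L : ℕ} [NeZero L]

section General

omit [NeZero L] in
/-- Unfolding lemma: the `SU(2)` loop variable of `WordLoop.lean`, written out. [folklore] -/
theorem wordLoop_suRep_two (x : Site d L) (w : Word d) :
    wordLoop (suRep 2) x w = fun U : GaugeConfig d L (SU 2) =>
      ((2 : ℕ) : ℝ)⁻¹ * ((fundamentalRep (Fin 2) (wordHolonomy U x w)).trace).re := rfl

/-- `SU(2)`: the complex expectation of `tr U_w` is `2·E_w`. [folklore] -/
theorem integral_trace_su_two_wordLoop (β : ℝ) (x : Site d L) (w : Word d) :
    ∫ U, (fundamentalRep (Fin 2) (wordHolonomy U x w)).trace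
        ∂(wilsonMeasure (d := d) (L := L) (fundamentalRep (Fin 2)) β) =
      (((2 : ℝ) * wilsonExpectation (d := d) (L := L) (suRep 2) β (wordLoop (suRep 2) x w) : ℝ) : ℂ) := by
  rw [integral_trace_su_two, wordLoop_suRep_two]

/-- **`SU(2)`: every plaquette term integrates to single loop variables**:
`∫ plaqTerm_{ν,ε}(w) dμ_β = 2·(E_{w·P̃(ν,ε)} − E_{w·P̃(ν,ε)⁻¹})` (no double traces for `SU(2)`). [folklore] -/
theorem integral_plaqTerm_su_two (s : ℂ) (β : ℝ) (x : Site d L) (μ : Fin d) (w : Word d) (ν : Fin d) (ε : Bool) :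
    ∫ U, plaqTerm (fundamentalRep (Fin 2)) s x μ U w ν ε
        ∂(wilsonMeasure (d := d) (L := L) (fundamentalRep (Fin 2)) β) =
      (((2 : ℝ) * (wilsonExpectation (d := d) (L := L) (suRep 2) β (wordLoop (suRep 2) x (w ++ plaqWord μ ν ε)) -
        wilsonExpectation (d := d) (L := L) (suRep 2) β
          (wordLoop (suRep 2) x (w ++ (plaqWord μ ν ε).reverse))) : ℝ) : ℂ) := by
  simp_rw [plaqTerm_su_two]
  have hi : ∀ v : Word d, Integrable (fun U : GaugeConfig d L (SU 2) =>
      (fundamentalRep (Fin 2) (wordHolonomy U x v)).trace) (wilsonMeasure (d := d) (L := L) (fundamentalRep (Fin 2)) β) :=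
    fun v => integrable_of_continuous (fundamentalLatticeRep 2) β
      (continuous_trace_wordHolonomy (fundamentalLatticeRep 2) x v)
  rw [integral_sub (hi _) (hi _), integral_trace_su_two_wordLoop, integral_trace_su_two_wordLoop]
  push_cast
  ring

/-- **(1eq) for `SU(N)` in every dimension** (any `N`, `μ ≠ ν`, `L ≥ 2`): for `P = +μ +ν −μ −ν` and the link
`(x, μ)`, `(N − 1/N)·E[tr U_P] + (β/2)·Σ_{ν' ≠ μ} Σ_{ε} E[plaqTerm_{ν',ε}(P)] = 0`. [folklore] -/
theorem oneEq_specialUnitaryGroup_dim (N : ℕ) (hL : (1 : ZMod L) ≠ 0) (β : ℝ) (x : Site d L) {μ ν : Fin d}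
    (hμν : μ ≠ ν) :
    ((N : ℂ) - 1 / N) * ∫ U, (fundamentalRep (Fin N) (wordHolonomy U x (Word.plaquette μ ν))).trace
        ∂(wilsonMeasure (d := d) (L := L) (fundamentalRep (Fin N)) β) +
      (β / 2 : ℂ) * ∑ ν' ∈ Finset.univ.erase μ, ∑ ε : Bool,
        ∫ U, plaqTerm (fundamentalRep (Fin N)) 1 x μ U (Word.plaquette μ ν) ν' ε
          ∂(wilsonMeasure (d := d) (L := L) (fundamentalRep (Fin N)) β) = 0 :=
  loopEquation_plaquette (L := L) (fundamentalLatticeRep N) hL β x hμν 1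
    fun i j => sdPair_specialUnitaryGroup N β x μ x _ _ (trace_unitDir_one i j)

/-- **(2eq) for `SU(N)` in every dimension**: for `S = +μ +μ +ν −μ −ν −μ` and the link `(x, μ)`,
`(β/2)·Σ_{ν' ≠ μ} Σ_{ε} E[plaqTerm_{ν',ε}(S)] = 0`. [folklore] -/
theorem twoEq_specialUnitaryGroup_dim (N : ℕ) (hL : (1 : ZMod L) ≠ 0) (β : ℝ) (x : Site d L) {μ ν : Fin d}
    (hμν : μ ≠ ν) :
    (β / 2 : ℂ) * ∑ ν' ∈ Finset.univ.erase μ, ∑ ε : Bool,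
        ∫ U, plaqTerm (fundamentalRep (Fin N)) 1 x μ U (Word.spurPlaquette μ ν) ν' ε
          ∂(wilsonMeasure (d := d) (L := L) (fundamentalRep (Fin N)) β) = 0 :=
  loopEquation_spurPlaquette (L := L) (fundamentalLatticeRep N) hL β x hμν 1
    fun i j => sdPair_specialUnitaryGroup N β x μ x _ _ (trace_unitDir_one i j)

/-- **(1eq) for `U(N)` in every dimension** (`s = 0`): `N·E[tr U_P] + (β/2)·Σ_{ν' ≠ μ} Σ_{ε} E[plaqTerm_{ν',ε}(P)] = 0`.
[folklore] -/
theorem oneEq_unitaryGroup_dim (N : ℕ) (hL : (1 : ZMod L) ≠ 0) (β : ℝ) (x : Site d L) {μ ν : Fin d}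
    (hμν : μ ≠ ν) :
    (N : ℂ) * ∫ U, (unitaryFundamentalRep (Fin N) ℂ (wordHolonomy U x (Word.plaquette μ ν))).trace
        ∂(wilsonMeasure (d := d) (L := L) (unitaryFundamentalRep (Fin N) ℂ) β) +
      (β / 2 : ℂ) * ∑ ν' ∈ Finset.univ.erase μ, ∑ ε : Bool,
        ∫ U, plaqTerm (unitaryFundamentalRep (Fin N) ℂ) 0 x μ U (Word.plaquette μ ν) ν' ε
          ∂(wilsonMeasure (d := d) (L := L) (unitaryFundamentalRep (Fin N) ℂ) β) = 0 := by
  have h := loopEquation_plaquette (L := L) (unitaryFundamentalLatticeRep N) hL β x hμν 0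
    fun _ _ => sdPair_unitaryGroup N β x μ x _ _
  rw [zero_div, sub_zero] at h
  exact h

/-- **(2eq) for `U(N)` in every dimension**. [folklore] -/
theorem twoEq_unitaryGroup_dim (N : ℕ) (hL : (1 : ZMod L) ≠ 0) (β : ℝ) (x : Site d L) {μ ν : Fin d}
    (hμν : μ ≠ ν) :
    (β / 2 : ℂ) * ∑ ν' ∈ Finset.univ.erase μ, ∑ ε : Bool,
        ∫ U, plaqTerm (unitaryFundamentalRep (Fin N) ℂ) 0 x μ U (Word.spurPlaquette μ ν) ν' ε
          ∂(wilsonMeasure (d := d) (L := L) (unitaryFundamentalRep (Fin N) ℂ) β) = 0 :=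
  loopEquation_spurPlaquette (L := L) (unitaryFundamentalLatticeRep N) hL β x hμν 0
    fun _ _ => sdPair_unitaryGroup N β x μ x _ _

/-- **(1eq) for `SU(2)` in every dimension, loop variables.**  For the plaquette `P = +μ +ν −μ −ν` at `x` and the link
`(x, μ)` (`μ ≠ ν`, `L ≥ 2`, tree coupling `β`):
`3·E_P + β·Σ_{ν' ≠ μ} Σ_{ε} (E_{P·P̃(ν',ε)} − E_{P·P̃(ν',ε)⁻¹}) = 0`. [folklore] -/
theorem oneEq_su_two_wordLoop (hL : (1 : ZMod L) ≠ 0) (β : ℝ) (x : Site d L) {μ ν : Fin d} (hμν : μ ≠ ν) :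
    3 * wilsonExpectation (d := d) (L := L) (suRep 2) β (wordLoop (suRep 2) x (Word.plaquette μ ν)) +
      β * ∑ ν' ∈ Finset.univ.erase μ, ∑ ε : Bool,
        (wilsonExpectation (d := d) (L := L) (suRep 2) β (wordLoop (suRep 2) x (Word.plaquette μ ν ++ plaqWord μ ν' ε)) -
          wilsonExpectation (d := d) (L := L) (suRep 2) β
            (wordLoop (suRep 2) x (Word.plaquette μ ν ++ (plaqWord μ ν' ε).reverse))) = 0 := by
  have h := oneEq_specialUnitaryGroup_dim (L := L) 2 hL β x hμν
  simp only [integral_plaqTerm_su_two, integral_trace_su_two_wordLoop] at h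
  apply Complex.ofReal_injective
  push_cast at h ⊢
  simp only [← Finset.mul_sum] at h
  linear_combination h

/-- **(2eq) for `SU(2)` in every dimension, loop variables.**  For the spur-plaquette word `S = +μ +μ +ν −μ −ν −μ` at
`x` and the link `(x, μ)` (`μ ≠ ν`, `L ≥ 2`): `β·Σ_{ν' ≠ μ} Σ_{ε} (E_{S·P̃(ν',ε)} − E_{S·P̃(ν',ε)⁻¹}) = 0`. [folklore] -/
theorem twoEq_su_two_wordLoop (hL : (1 : ZMod L) ≠ 0) (β : ℝ) (x : Site d L) {μ ν : Fin d} (hμν : μ ≠ ν) :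
    β * ∑ ν' ∈ Finset.univ.erase μ, ∑ ε : Bool,
        (wilsonExpectation (d := d) (L := L) (suRep 2) β
            (wordLoop (suRep 2) x (Word.spurPlaquette μ ν ++ plaqWord μ ν' ε)) -
          wilsonExpectation (d := d) (L := L) (suRep 2) β
            (wordLoop (suRep 2) x (Word.spurPlaquette μ ν ++ (plaqWord μ ν' ε).reverse))) = 0 := by
  have h := twoEq_specialUnitaryGroup_dim (L := L) 2 hL β x hμν
  simp only [integral_plaqTerm_su_two] at h
  apply Complex.ofReal_injective
  push_cast at h ⊢
  simp only [← Finset.mul_sum] at h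
  linear_combination h

end General

section LowDimension

/-- In `d = 3` the axes other than `0` are `1, 2` (to expand the plaquette sum of the rows: `Finset.sum_pair`).
[folklore] -/
theorem univ_erase_zero_fin_three : (Finset.univ : Finset (Fin 3)).erase 0 = {1, 2} := by decide

/-- In `d = 4` the axes other than `0` are `1, 2, 3` (`Finset.sum_insert` + `Finset.sum_pair`). [folklore] -/
theorem univ_erase_zero_fin_four : (Finset.univ : Finset (Fin 4)).erase 0 = {1, 2, 3} := by decide

/-- **The in-plane backtracking term is trivial**: `E_{P·P̃(μ,ν,+)⁻¹} = E_{P·P⁻¹} = 1` (`P̃(μ,ν,+) = P`), in every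
dimension and for every base point. [folklore] -/
theorem wilsonExpectation_wordLoop_plaquette_append_reverse (β : ℝ) (x : Site d L) (μ ν : Fin d) :
    wilsonExpectation (d := d) (L := L) (suRep 2) β
        (wordLoop (suRep 2) x (Word.plaquette μ ν ++ (plaqWord μ ν true).reverse)) = 1 := by
  haveI := isProbabilityMeasure_wilsonMeasure (d := d) (L := L) (G := SU 2) (suRep 2) (continuous_suRep 2) β
  have h : wordLoop (suRep 2) x (Word.plaquette μ ν ++ (plaqWord μ ν true).reverse) =
      fun _ : GaugeConfig d L (SU 2) => (1 : ℝ) := by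
    funext U
    rw [wordLoop_apply, plaqWord_true, wordHolonomy_append_reverse, map_one, Matrix.trace_one, Fintype.card_fin]
    norm_num
  rw [h]
  simp [wilsonExpectation]

end LowDimension

end Summit.QuantumFields.GaugeBoot

end
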